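import Literature.Analysis.Complex.LaguerrePolya
import Literature.Analysis.Complex.DeBruijnUniversalFactorsProofs
import HarnessLib

/-!
# de Bruijn's shift lemma and universal factor `e^{λ²t²/2}` for roots in a strip (de Bruijn 1950, Thms. 8 and 13, general `Δ`)

Trunk T-ANALYSIS support (`Literature/Analysis/Complex`), serving the discharge of de Bruijn's
strip theorem `Literature.NumberTheory.LFunctions.de_bruijn_strip` (`Literature/NumberTheory/LFunctions/DeBruijnStrip.lean`;
de Bruijn 1950, Thm. 13 with general `Δ`, whence `Λ ≤ 1/2`) and, through it, of Newman's
characterisation `Literature.NumberTheory.LFunctions.hasOnlyRealZeros_deBruijnH_iff_deBruijnNewmanConst_le`.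

N. G. de Bruijn, *The roots of trigonometric integrals*, Duke Math. J. **17** (1950), 197–226.
The companion files `LaguerrePolya.lean` / `DeBruijnUniversalFactorsProofs.lean` treat the case
`Δ = 0` (real roots stay real). Here we prove the general case: roots in the strip `|Im z| ≤ Δ`
move into the strip `|Im z| ≤ √max(Δ² − λ², 0)`.

## Contents (all proved)

* `Literature.Analysis.Complex.exists_eq_prod_mul_exp` — local structure of an entire `f` with `f(c) ≠ 0`
  (a repackaging of Titchmarsh's Lemma α, `Literature.Analysis.Complex.titchmarsh_logDeriv_sub_sum`): on the ball
  `‖z − c‖ < R`, `f = K · ∏_{a ∈ S} (z − a)^{m(a)} · e^{Φ}` with `S ⊇` the zeros in `‖a − c‖ ≤ R`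
  and `Φ'` Lipschitz with constant `64 (log(M/|f(c)|) + 1)/R²` on `‖z − c‖ ≤ R/8`.
* `Literature.Analysis.Complex.deBruijn_pair_sq_sub_sq`, `Literature.Analysis.Complex.deBruijn_pair_lt` — **de Bruijn 1950,
  Lemma 1** (p. 200) for a conjugate pair: with `z = x + iy`, `a = β + iγ`, `λ > 0`,
  `(|z+iλ−a| |z+iλ−ā|)² − (|z−iλ−a| |z−iλ−ā|)² = 8λy((x−β)² + y² + λ² − γ²)`, positive when
  `y > 0` and `γ² < y² + λ²`.
* `Literature.Analysis.Complex.norm_shift_lt_of_strip` — the entire-function form of de Bruijn's Thm. 3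
  inequality for strips: if `f` is real entire of order `< 2` with at least one zero and all zeros
  in `|Im z| ≤ Δ`, `λ > 0`, `Im z > 0` and `Δ² < (Im z)² + λ²`, then `|f(z − iλ)| < |f(z + iλ)|`.
  Proof (Hadamard-free): `|f(w)|² = |f(w)| |f(w̄)|` (Schwarz reflection), so in the local
  factorisation the polynomial part contributes `∏ (|w − a| |w − ā|)^{m(a)}` — each factor obeys
  Lemma 1 — while the zero-free part `e^{Φ}` contributes the *second difference*
  `Φ(z+iλ) − Φ(z−iλ) − Φ(z̄+iλ) + Φ(z̄−iλ)`, of size `≤ 4λy · sup |Φ''| = O(R^{ρ−2}) → 0`.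
* `Literature.Analysis.Complex.deBruijn_shift_strip_dichotomy`, `Literature.Analysis.Complex.deBruijn_iterate_shift_strip_dichotomy`
  — **de Bruijn 1950, Thm. 8** (p. 203) for `N = 1` and for `φ(u) = (1 + u)^M`: for `f` real
  entire of order `< 2` with roots in `|Im z| ≤ Δ`, `f(z + iλ) + f(z − iλ)` is `≡ 0` or has its
  roots in `|Im z| ≤ √max(Δ² − λ², 0)`; the `M`-fold iterate is `≡ 0` or has its roots in
  `|Im z| ≤ √max(Δ² − Mλ², 0)`.
* `Literature.Analysis.Complex.DeBruijn1950.rootsInStrip_gaussian` — **de Bruijn 1950, Thm. 13** (p. 205; the named fact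
  `Literature.Analysis.Complex.DeBruijn1950.thm13` with the harmless extra hypothesis that the target function is `≢ 0`):
  for an admissible kernel `F`, if the roots of `∫ F(t) e^{izt} dt` lie in `|Im z| ≤ Δ` then those
  of `∫ F(t) e^{λ²t²/2} e^{izt} dt` lie in `|Im z| ≤ √max(Δ² − λ², 0)`. Proof as printed
  (`cosh(λt/N)^{N²} → e^{λ²t²/2}`, `N²` shifts of step `λ/N`, Hurwitz), with Thm. 8 as above.

## References

* N. G. de Bruijn, *The roots of trigonometric integrals*, Duke Math. J. 17 (1950), 197–226,
  Lemma 1 (p. 200), Thm. 3 (p. 201), Thm. 8 (p. 203), Thms. 11–13 (pp. 204–205).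
* E. C. Titchmarsh, *The theory of the Riemann zeta-function*, 2nd ed., Oxford 1986, §3.9 Lemma α.
-/

noncomputable section

open Complex Filter Metric Set Topology
open scoped ComplexConjugate

namespace Literature.Analysis.Complex

variable {f : ℂ → ℂ}

/-! ## Local factorisation `f = K · ∏ (z − a)^{m(a)} · e^{Φ}` with `Φ'` almost constant -/

/-- **Local structure of an entire function near its zeros** (Titchmarsh's Lemma α, repackaged).
Let `f` be entire, `f(c) ≠ 0`, `‖f‖ ≤ M` on `‖z − c‖ ≤ 2R`. Then on the ball `‖z − c‖ < R`,
`f(z) = K ∏_{a ∈ S} (z − a)^{m(a)} e^{Φ(z)}` where `S` is a finite set of zeros of `f` containing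
all zeros with `‖a − c‖ ≤ R`, `m ≥ 1`, `Φ` is holomorphic on the ball, and `Φ'` is Lipschitz on
`‖z − c‖ ≤ R/8` with constant `64 (log(M/‖f(c)‖) + 1)/R²`. (From
`titchmarsh_logDeriv_sub_sum`: `Φ` is a primitive of `ψ = f'/f − ∑ m(a)/(z − a)`; the quotient
`f e^{−Φ}/∏(z − a)^{m(a)}` has zero derivative near `c`, and the identity theorem.)
[cite: Titchmarsh1986, §3.9 Lemma α] -/
theorem exists_eq_prod_mul_exp (hf : Differentiable ℂ f) {c : ℂ} (hc : f c ≠ 0) {R M : ℝ}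
    (hR : 0 < R) (hM : ∀ z ∈ closedBall c (2 * R), ‖f z‖ ≤ M) :
    ∃ (S : Finset ℂ) (m : ℂ → ℕ) (Φ : ℂ → ℂ) (K : ℂ),
      (∀ a ∈ S, f a = 0 ∧ 0 < m a) ∧ (∀ a, f a = 0 → ‖a - c‖ ≤ R → a ∈ S) ∧
      DifferentiableOn ℂ Φ (ball c R) ∧
      (∀ z ∈ ball c R, f z = K * (∏ a ∈ S, (z - a) ^ m a) * exp (Φ z)) ∧
      ∀ z ∈ closedBall c (R / 8), ∀ w ∈ closedBall c (R / 8),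
        ‖deriv Φ z - deriv Φ w‖ ≤ 64 * (Real.log (M / ‖f c‖) + 1) / R ^ 2 * ‖z - w‖ := by
  obtain ⟨S, m, ψ, hS, hS', hψd, hψeq, -, hψ'⟩ := titchmarsh_logDeriv_sub_sum hf hc hR hM
  obtain ⟨Φ, hΦc, hΦ⟩ := hψd.isExactOn_ball.with_val_at c 0
  have hΦd : DifferentiableOn ℂ Φ (ball c R) := fun z hz ↦
    (hΦ z hz).differentiableAt.differentiableWithinAt
  have hderiv : ∀ z ∈ ball c R, deriv Φ z = ψ z := fun z hz ↦ (hΦ z hz).deriv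
  set P : ℂ → ℂ := fun z ↦ ∏ a ∈ S, (z - a) ^ m a with hP
  have hPd : Differentiable ℂ P := differentiable_prod_pow_sub S m
  have hcS : ∀ a ∈ S, c ≠ a := fun a ha h ↦ hc (by rw [h]; exact (hS a ha).1)
  have hPc : P c ≠ 0 := prod_pow_sub_ne_zero m hcS
  set K : ℂ := f c / P c with hK
  refine ⟨S, m, Φ, K, fun a ha ↦ ⟨(hS a ha).1, (hS a ha).2.1⟩, hS', hΦd, ?_, ?_⟩
  · -- Step 1: `f ≠ 0` on a small ball around `c`
    obtain ⟨δ, hδ, hδR, hfnz⟩ : ∃ δ > 0, δ ≤ R ∧ ∀ z ∈ ball c δ, f z ≠ 0 := by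
      have h1 : ∀ᶠ z in 𝓝 c, f z ≠ 0 := (hf.continuous.continuousAt).eventually_ne hc
      obtain ⟨δ, hδ, hball⟩ := Metric.eventually_nhds_iff_ball.1 h1
      exact ⟨min δ R, lt_min hδ hR, min_le_right _ _,
        fun z hz ↦ hball z (ball_subset_ball (min_le_left _ _) hz)⟩
    have hsub : ball c δ ⊆ ball c R := ball_subset_ball hδR
    have hzS : ∀ z ∈ ball c δ, ∀ a ∈ S, z ≠ a := fun z hz a ha h ↦
      hfnz z hz (by rw [h]; exact (hS a ha).1)
    have hPnz : ∀ z ∈ ball c δ, P z ≠ 0 := fun z hz ↦ prod_pow_sub_ne_zero m (hzS z hz)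
    -- Step 2: `h = f e^{-Φ} / P` has zero derivative on `ball c δ`
    have hhd : ∀ z ∈ ball c δ,
        HasDerivAt (fun w ↦ f w * exp (-Φ w) * (P w)⁻¹) 0 z := by
      intro z hz
      have hzR := hsub hz
      have h1 : HasDerivAt f (deriv f z) z := (hf z).hasDerivAt
      have h2 : HasDerivAt (fun w ↦ exp (-Φ w)) (exp (-Φ z) * -ψ z) z := (hΦ z hzR).neg.cexp
      have h3 : HasDerivAt P (deriv P z) z := (hPd z).hasDerivAt
      have h4 : HasDerivAt (fun w ↦ (P w)⁻¹) (-(deriv P z) / (P z) ^ 2) z :=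
        h3.fun_inv (hPnz z hz)
      have hψz : ψ z = deriv f z / f z - deriv P z / P z := by
        rw [hψeq z hzR (hfnz z hz), ← deriv_prod_pow_sub_div m (hzS z hz)]
      refine ((h1.fun_mul h2).fun_mul h4).congr_deriv ?_
      rw [hψz]
      field_simp [hfnz z hz, hPnz z hz]
      ring
    -- Step 3: `h` is constant `= K` on `ball c δ`
    have hconst : ∀ z ∈ ball c δ, f z * exp (-Φ z) * (P z)⁻¹ = f c * exp (-Φ c) * (P c)⁻¹ :=
      fun z hz ↦ isOpen_ball.is_const_of_deriv_eq_zero (convex_ball c δ).isPreconnected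
        (fun w hw ↦ (hhd w hw).differentiableAt.differentiableWithinAt)
        (fun w hw ↦ (hhd w hw).deriv) hz (mem_ball_self hδ)
    have hloc : ∀ z ∈ ball c δ, f z = K * P z * exp (Φ z) := by
      intro z hz
      have h := hconst z hz
      rw [hΦc, neg_zero, Complex.exp_zero, mul_one] at h
      have hPz := hPnz z hz
      have hK' : K = f z * exp (-Φ z) * (P z)⁻¹ := by rw [h, hK, div_eq_mul_inv]
      rw [hK']
      field_simp
      rw [mul_assoc, ← Complex.exp_add, neg_add_cancel, Complex.exp_zero, mul_one]
    -- Step 4: identity theorem on `ball c R`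
    have hF₁ : AnalyticOnNhd ℂ f (ball c R) := hf.differentiableOn.analyticOnNhd isOpen_ball
    have hF₂ : AnalyticOnNhd ℂ (fun z ↦ K * P z * exp (Φ z)) (ball c R) := by
      apply DifferentiableOn.analyticOnNhd _ isOpen_ball
      exact ((differentiableOn_const K).mul hPd.differentiableOn).mul hΦd.cexp
    have hev : f =ᶠ[𝓝 c] fun z ↦ K * P z * exp (Φ z) :=
      Filter.eventuallyEq_of_mem (ball_mem_nhds c hδ) fun z hz ↦ hloc z hz
    intro z hz
    exact hF₁.eqOn_of_preconnected_of_eventuallyEq hF₂ (convex_ball c R).isPreconnected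
      (mem_ball_self hR) hev hz
  · -- Lipschitz bound for `Φ' = ψ` on `closedBall c (R/8)`
    intro z hz w hw
    have hsub : closedBall c (R / 8) ⊆ ball c R := closedBall_subset_ball (by linarith)
    rw [hderiv z (hsub hz), hderiv w (hsub hw)]
    exact (convex_closedBall c (R / 8)).norm_image_sub_le_of_norm_deriv_le
      (fun x hx ↦ hψd.differentiableAt (isOpen_ball.mem_nhds (hsub hx))) (fun x hx ↦ hψ' x hx)
      hw hz

/-! ## de Bruijn's Lemma 1 for a conjugate pair of roots -/

/-- **de Bruijn 1950, Lemma 1** (p. 200), pair form: for `z = x + iy`, `a = β + iγ`, real `λ`,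
`(|z + iλ − a| |z + iλ − ā|)² − (|z − iλ − a| |z − iλ − ā|)² = 8λy ((x − β)² + y² + λ² − γ²)`.
[cite: Bruijn1950, Lemma 1] -/
theorem deBruijn_pair_sq_sub_sq (z a : ℂ) (lam : ℝ) :
    (‖z + I * lam - a‖ * ‖z + I * lam - conj a‖) ^ 2 -
        (‖z - I * lam - a‖ * ‖z - I * lam - conj a‖) ^ 2 =
      8 * lam * z.im * ((z.re - a.re) ^ 2 + z.im ^ 2 + lam ^ 2 - a.im ^ 2) := by
  simp only [mul_pow, ← Complex.normSq_eq_norm_sq, Complex.normSq_apply, add_re, sub_re, mul_re,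
    I_re, ofReal_re, zero_mul, I_im, ofReal_im, mul_zero, sub_zero, add_zero, conj_re, add_im,
    sub_im, mul_im, one_mul, zero_add, conj_im]
  ring

/-- **de Bruijn 1950, Lemma 1**, the inequality: if `λ > 0`, `Im z > 0` and
`(Im a)² < (Im z)² + λ²`, then `|z − iλ − a| |z − iλ − ā| < |z + iλ − a| |z + iλ − ā|`.
[cite: Bruijn1950, Lemma 1] -/
theorem deBruijn_pair_lt {z a : ℂ} {lam : ℝ} (hlam : 0 < lam) (hy : 0 < z.im)
    (ha : a.im ^ 2 < z.im ^ 2 + lam ^ 2) :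
    ‖z - I * lam - a‖ * ‖z - I * lam - conj a‖ < ‖z + I * lam - a‖ * ‖z + I * lam - conj a‖ := by
  have h := deBruijn_pair_sq_sub_sq z a lam
  have hpos : 0 < 8 * lam * z.im * ((z.re - a.re) ^ 2 + z.im ^ 2 + lam ^ 2 - a.im ^ 2) := by
    have : 0 < (z.re - a.re) ^ 2 + z.im ^ 2 + lam ^ 2 - a.im ^ 2 := by
      nlinarith [sq_nonneg (z.re - a.re)]
    positivity
  rw [← sq_lt_sq₀ (by positivity) (by positivity)]
  linarith

/-! ## The strip inequality `|f(z − iλ)| < |f(z + iλ)|` -/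

/-- Norm of the polynomial factor at `w` and `w̄`, paired:
`‖∏ (w − a)^{m a}‖ ‖∏ (w̄ − a)^{m a}‖ = ∏ (‖w − a‖ ‖w − ā‖)^{m a}`. [folklore] -/
theorem norm_prod_pow_sub_mul_conj (S : Finset ℂ) (m : ℂ → ℕ) (w : ℂ) :
    ‖∏ a ∈ S, (w - a) ^ m a‖ * ‖∏ a ∈ S, (conj w - a) ^ m a‖ =
      ∏ a ∈ S, (‖w - a‖ * ‖w - conj a‖) ^ m a := by
  rw [norm_prod, norm_prod, ← Finset.prod_mul_distrib]
  refine Finset.prod_congr rfl fun a _ ↦ ?_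
  rw [norm_pow, norm_pow, mul_pow]
  congr 2
  rw [← Complex.norm_conj (conj w - a), map_sub, Complex.conj_conj]

/-- **The strip inequality (de Bruijn 1950, Lemma 1 / Thm. 3, entire-function form; Hadamard-free).**
Let `f` be real entire of order `< 2` (`‖f‖ ≤ C e^{‖z‖^ρ}`, `0 ≤ ρ < 2`, `f(ℝ) ⊆ ℝ`) with all
zeros in the strip `|Im z| ≤ Δ` and at least one zero `a₀`. If `λ > 0`, `Im z > 0` and
`Δ² < (Im z)² + λ²`, then `‖f(z − iλ)‖ < ‖f(z + iλ)‖`. [cite: Bruijn1950, Lemma 1] -/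
theorem norm_shift_lt_of_strip (hf : Differentiable ℂ f) {ρ C : ℝ} (hρ0 : 0 ≤ ρ) (hρ : ρ < 2)
    (hgr : ∀ z, ‖f z‖ ≤ C * Real.exp (‖z‖ ^ ρ)) (hreal : ∀ x : ℝ, (f x).im = 0)
    {Δ : ℝ} (hzero : ∀ z, f z = 0 → |z.im| ≤ Δ) {a₀ : ℂ} (ha₀ : f a₀ = 0)
    {lam : ℝ} (hlam : 0 < lam) {z : ℂ} (hz : 0 < z.im) (hzΔ : Δ ^ 2 < z.im ^ 2 + lam ^ 2) :
    ‖f (z - I * lam)‖ < ‖f (z + I * lam)‖ := by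
  classical
  -- every zero `a` satisfies `(Im a)² < (Im z)² + λ²`
  have hzero2 : ∀ a, f a = 0 → a.im ^ 2 < z.im ^ 2 + lam ^ 2 := fun a ha ↦ by
    have h1 : a.im ^ 2 ≤ Δ ^ 2 := by
      have h := hzero a ha
      calc a.im ^ 2 = |a.im| ^ 2 := (sq_abs _).symm
        _ ≤ Δ ^ 2 := pow_le_pow_left₀ (abs_nonneg _) h 2
    linarith
  have hconjzero : ∀ a, f a = 0 → f (conj a) = 0 := fun a ha ↦ by
    rw [apply_conj_eq_conj hf hreal, ha, map_zero]
  -- `f(z + iλ) ≠ 0`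
  have hwp : f (z + I * lam) ≠ 0 := fun h ↦ by
    have h1 := hzero2 _ h
    have h2 : (z + I * lam).im = z.im + lam := by simp
    rw [h2] at h1
    nlinarith
  -- trivial case `f(z − iλ) = 0`
  rcases eq_or_ne (f (z - I * lam)) 0 with h0 | hwm
  · rw [h0, norm_zero]; exact norm_pos_iff.2 hwp
  by_contra hcon
  push Not at hcon
  -- a real base point
  obtain ⟨c, hc⟩ := exists_ofReal_ne_zero hf ⟨_, hwp⟩
  have hCpos : 0 < C := growthConst_pos hgr hc
  have hfc : 0 < ‖f (c : ℂ)‖ := norm_pos_iff.2 hc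
  -- the gap coming from the zero `a₀`
  set A₀ : ℝ := ‖z + I * lam - a₀‖ * ‖z + I * lam - conj a₀‖ with hA₀
  set B₀ : ℝ := ‖z - I * lam - a₀‖ * ‖z - I * lam - conj a₀‖ with hB₀
  have hB₀pos : 0 < B₀ := by
    have h1 : z - I * lam - a₀ ≠ 0 := fun h ↦ hwm (by rw [sub_eq_zero.1 h]; exact ha₀)
    have h2 : z - I * lam - conj a₀ ≠ 0 := fun h ↦
      hwm (by rw [sub_eq_zero.1 h]; exact hconjzero a₀ ha₀)
    have := norm_pos_iff.2 h1
    have := norm_pos_iff.2 h2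
    positivity
  have hAB : B₀ < A₀ := deBruijn_pair_lt hlam hz (hzero2 a₀ ha₀)
  set q₀ : ℝ := A₀ / B₀ with hq₀
  have hq₀1 : 1 < q₀ := (one_lt_div hB₀pos).2 hAB
  -- choice of the radius `R`
  set y : ℝ := z.im with hy
  set d : ℝ := ‖z - c‖ + lam with hd
  have hd0 : 0 ≤ d := by positivity
  set K₀ : ℝ := Real.log C - Real.log ‖f (c : ℂ)‖ + 1 with hK₀
  have hlim : Tendsto (fun R : ℝ ↦
      Real.exp (4 * lam * y * (64 * ((K₀ + (|c| + 2 * R) ^ ρ) / R ^ 2)))) atTop (𝓝 1) := by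
    have h := ((tendsto_growth_div_sq K₀ c hρ0 hρ).const_mul 64).const_mul (4 * lam * y)
    rw [mul_zero, mul_zero] at h
    have := (Real.continuous_exp.tendsto 0).comp h
    rwa [Real.exp_zero] at this
  obtain ⟨R, hRq, hRge⟩ := ((hlim.eventually_lt_const hq₀1).and
    (eventually_ge_atTop (max (max (‖a₀ - c‖ + 1) 1) (8 * d + 1)))).exists
  have hR1 : 1 ≤ R := ((le_max_right _ _).trans (le_max_left _ _)).trans hRge
  have hRpos : 0 < R := by linarith
  have hRa₀ : ‖a₀ - c‖ ≤ R := by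
    linarith [((le_max_left _ _).trans (le_max_left _ _)).trans hRge]
  have hRd : 8 * d + 1 ≤ R := (le_max_right _ _).trans hRge
  -- the local factorisation on `‖w - c‖ < R`
  set M : ℝ := C * Real.exp ((|c| + 2 * R) ^ ρ) with hM
  obtain ⟨S, m, Φ, K, hS, hS', hΦd, hfact, hLip⟩ :=
    exists_eq_prod_mul_exp hf hc hRpos (norm_le_on_closedBall hρ0 hgr c R)
  have hlog : Real.log (M / ‖f (c : ℂ)‖) + 1 = K₀ + (|c| + 2 * R) ^ ρ := by
    rw [hK₀, hM, Real.log_div (by positivity) hfc.ne', Real.log_mul hCpos.ne' (Real.exp_pos _).ne',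
      Real.log_exp]
    ring
  set ε : ℝ := 64 * ((K₀ + (|c| + 2 * R) ^ ρ) / R ^ 2) with hε
  have hε0 : 0 ≤ ε := by
    have h1 : 0 ≤ K₀ + (|c| + 2 * R) ^ ρ := by
      rw [← hlog]
      have : 1 ≤ M / ‖f (c : ℂ)‖ := by
        rw [le_div_iff₀ hfc, one_mul]
        exact norm_le_on_closedBall hρ0 hgr c R c (mem_closedBall_self (by positivity))
      have := Real.log_nonneg this
      positivity
    positivity
  have hLip' : ∀ v ∈ closedBall (c : ℂ) (R / 8), ∀ w ∈ closedBall (c : ℂ) (R / 8),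
      ‖deriv Φ v - deriv Φ w‖ ≤ ε * ‖v - w‖ := by
    intro v hv w hw
    have h := hLip v hv w hw
    rwa [hlog, show 64 * (K₀ + (|c| + 2 * R) ^ ρ) / R ^ 2 = ε by rw [hε]; ring] at h
  set P : ℂ → ℂ := fun w ↦ ∏ a ∈ S, (w - a) ^ m a with hP
  -- points of interest lie in `closedBall c (R/8) ⊆ ball c R`
  have hsub : closedBall (c : ℂ) (R / 8) ⊆ ball (c : ℂ) R := closedBall_subset_ball (by linarith)
  have hmem : ∀ s : ℝ, |s| ≤ lam → z + I * s ∈ closedBall (c : ℂ) (R / 8) := by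
    intro s hs
    rw [mem_closedBall, dist_eq_norm]
    calc ‖z + I * s - c‖ = ‖(z - c) + I * s‖ := by ring_nf
      _ ≤ ‖z - c‖ + ‖I * (s : ℂ)‖ := norm_add_le _ _
      _ = ‖z - c‖ + |s| := by simp
      _ ≤ d := by rw [hd]; linarith
      _ ≤ R / 8 := by linarith
  have hmem' : ∀ s : ℝ, |s| ≤ lam → conj z + I * s ∈ closedBall (c : ℂ) (R / 8) := by
    intro s hs
    rw [mem_closedBall, dist_eq_norm]
    have h1 : conj z + I * s - c = conj (z + I * (-s : ℝ) - c) := by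
      apply Complex.ext <;> simp
    calc ‖conj z + I * s - c‖ = ‖z + I * (-s : ℝ) - c‖ := by rw [h1, Complex.norm_conj]
      _ ≤ R / 8 := by
          have := hmem (-s) (by rwa [abs_neg])
          rwa [mem_closedBall, dist_eq_norm] at this
  have hlam' : |lam| ≤ lam := (abs_of_pos hlam).le
  have hnlam' : |(-lam)| ≤ lam := by rw [abs_neg]; exact hlam'
  -- the four points
  have hep : z + I * lam = z + I * (lam : ℝ) := rfl
  have hem : z - I * lam = z + I * ((-lam : ℝ) : ℂ) := by push_cast; ring
  have hecp : conj (z + I * lam) = conj z + I * ((-lam : ℝ) : ℂ) := by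
    apply Complex.ext <;> simp
  have hecm : conj (z - I * lam) = conj z + I * (lam : ℝ) := by
    apply Complex.ext <;> simp
  have hwpB : z + I * lam ∈ ball (c : ℂ) R := hsub (hmem lam hlam')
  have hwmB : z - I * lam ∈ ball (c : ℂ) R := by rw [hem]; exact hsub (hmem (-lam) hnlam')
  have hcwpB : conj (z + I * lam) ∈ ball (c : ℂ) R := by rw [hecp]; exact hsub (hmem' (-lam) hnlam')
  have hcwmB : conj (z - I * lam) ∈ ball (c : ℂ) R := by rw [hecm]; exact hsub (hmem' lam hlam')
  -- norms via the factorisation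
  have hnormf : ∀ w ∈ ball (c : ℂ) R, ‖f w‖ = ‖K‖ * ‖P w‖ * Real.exp (Φ w).re := by
    intro w hw
    rw [hfact w hw, norm_mul, norm_mul, Complex.norm_exp]
  have hsqp : ‖f (z + I * lam)‖ ^ 2 =
      ‖K‖ ^ 2 * (∏ a ∈ S, (‖z + I * lam - a‖ * ‖z + I * lam - conj a‖) ^ m a) *
        Real.exp ((Φ (z + I * lam)).re + (Φ (conj (z + I * lam))).re) := by
    rw [sq, ← norm_prod_pow_sub_mul_conj S m, Real.exp_add]
    nth_rewrite 2 [← norm_apply_conj hf hreal]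
    rw [hnormf _ hwpB, hnormf _ hcwpB]
    ring
  have hsqm : ‖f (z - I * lam)‖ ^ 2 =
      ‖K‖ ^ 2 * (∏ a ∈ S, (‖z - I * lam - a‖ * ‖z - I * lam - conj a‖) ^ m a) *
        Real.exp ((Φ (z - I * lam)).re + (Φ (conj (z - I * lam))).re) := by
    rw [sq, ← norm_prod_pow_sub_mul_conj S m, Real.exp_add]
    nth_rewrite 2 [← norm_apply_conj hf hreal]
    rw [hnormf _ hwmB, hnormf _ hcwmB]
    ring
  -- the polynomial part: `∏ A ≥ q₀ ∏ B`
  have ha₀S : a₀ ∈ S := hS' a₀ ha₀ hRa₀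
  have hPineq : q₀ * ∏ a ∈ S, (‖z - I * lam - a‖ * ‖z - I * lam - conj a‖) ^ m a ≤
      ∏ a ∈ S, (‖z + I * lam - a‖ * ‖z + I * lam - conj a‖) ^ m a := by
    set A : ℂ → ℝ := fun a ↦ (‖z + I * lam - a‖ * ‖z + I * lam - conj a‖) ^ m a with hA
    set B : ℂ → ℝ := fun a ↦ (‖z - I * lam - a‖ * ‖z - I * lam - conj a‖) ^ m a with hB
    have hBA : ∀ a ∈ S, B a ≤ A a := fun a ha ↦
      pow_le_pow_left₀ (by positivity) (deBruijn_pair_lt hlam hz (hzero2 a (hS a ha).1)).le _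
    have hB0 : ∀ a ∈ S, 0 ≤ B a := fun a _ ↦ by positivity
    rw [← Finset.mul_prod_erase S A ha₀S, ← Finset.mul_prod_erase S B ha₀S]
    have h1 : ∏ a ∈ S.erase a₀, B a ≤ ∏ a ∈ S.erase a₀, A a :=
      Finset.prod_le_prod (fun a ha ↦ hB0 a (Finset.mem_of_mem_erase ha))
        fun a ha ↦ hBA a (Finset.mem_of_mem_erase ha)
    have h2 : q₀ * B a₀ ≤ A a₀ := by
      have hm : 1 ≤ m a₀ := (hS a₀ ha₀S).2
      have hBa : B a₀ = B₀ ^ m a₀ := by simp only [hB, hB₀]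
      have hAa : A a₀ = A₀ ^ m a₀ := by simp only [hA, hA₀]
      rw [hBa, hAa, show A₀ = q₀ * B₀ by rw [hq₀, div_mul_cancel₀ _ hB₀pos.ne']]
      calc q₀ * B₀ ^ m a₀ = q₀ ^ 1 * B₀ ^ m a₀ := by rw [pow_one]
        _ ≤ q₀ ^ m a₀ * B₀ ^ m a₀ :=
            mul_le_mul_of_nonneg_right (pow_le_pow_right₀ hq₀1.le hm) (pow_nonneg hB₀pos.le _)
        _ = (q₀ * B₀) ^ m a₀ := (mul_pow _ _ _).symm
    have h3 : 0 ≤ ∏ a ∈ S.erase a₀, B a :=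
      Finset.prod_nonneg fun a ha ↦ hB0 a (Finset.mem_of_mem_erase ha)
    calc q₀ * (B a₀ * ∏ a ∈ S.erase a₀, B a) = (q₀ * B a₀) * ∏ a ∈ S.erase a₀, B a := by ring
      _ ≤ A a₀ * ∏ a ∈ S.erase a₀, A a :=
          mul_le_mul h2 h1 h3 ((mul_nonneg (by linarith) (hB0 a₀ ha₀S)).trans h2)
  -- the exponential part: a second difference of `Φ`
  have hΦineq : (Φ (z - I * lam)).re + (Φ (conj (z - I * lam))).re - 4 * lam * y * ε ≤
      (Φ (z + I * lam)).re + (Φ (conj (z + I * lam))).re := by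
    -- `γ(s) = Φ(z + is) − Φ(z̄ + is)` on `[-λ, λ]`
    set γ : ℝ → ℂ := fun s ↦ Φ (z + I * s) - Φ (conj z + I * s) with hγ
    have hΦat : ∀ w ∈ ball (c : ℂ) R, HasDerivAt Φ (deriv Φ w) w := fun w hw ↦
      (hΦd.differentiableAt (isOpen_ball.mem_nhds hw)).hasDerivAt
    have hγd : ∀ s ∈ Icc (-lam) lam, HasDerivAt γ
        (deriv Φ (z + I * s) * I - deriv Φ (conj z + I * s) * I) s := by
      intro s hs
      have hs' : |s| ≤ lam := abs_le.2 ⟨hs.1, hs.2⟩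
      have l1 : HasDerivAt (fun u : ℂ ↦ z + I * u) I (s : ℂ) := by
        simpa using ((hasDerivAt_id (s : ℂ)).const_mul I).const_add z
      have l2 : HasDerivAt (fun u : ℂ ↦ conj z + I * u) I (s : ℂ) := by
        simpa using ((hasDerivAt_id (s : ℂ)).const_mul I).const_add (conj z)
      have m1 : HasDerivAt (fun u : ℂ ↦ Φ (z + I * u)) (deriv Φ (z + I * s) * I) (s : ℂ) := by
        have := (hΦat _ (hsub (hmem s hs'))).comp (s : ℂ) l1
        simpa [Function.comp_def] using this
      have m2 : HasDerivAt (fun u : ℂ ↦ Φ (conj z + I * u)) (deriv Φ (conj z + I * s) * I)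
          (s : ℂ) := by
        have := (hΦat _ (hsub (hmem' s hs'))).comp (s : ℂ) l2
        simpa [Function.comp_def] using this
      exact (m1.sub m2).comp_ofReal
    have hγ'bound : ∀ s ∈ Ico (-lam) lam,
        ‖deriv Φ (z + I * s) * I - deriv Φ (conj z + I * s) * I‖ ≤ ε * (2 * y) := by
      intro s hs
      have hs' : |s| ≤ lam := abs_le.2 ⟨hs.1, hs.2.le⟩
      rw [← sub_mul, norm_mul, Complex.norm_I, mul_one]
      refine (hLip' _ (hmem s hs') _ (hmem' s hs')).trans (le_of_eq ?_)
      have hzz : z + I * s - (conj z + I * s) = ((2 * y : ℝ) : ℂ) * I := by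
        rw [show z + I * s - (conj z + I * s) = z - conj z by ring, Complex.sub_conj, hy]
      rw [hzz, norm_mul, Complex.norm_I, mul_one, Complex.norm_real, Real.norm_eq_abs,
        abs_of_pos (by positivity)]
    have hmv := norm_image_sub_le_of_norm_deriv_le_segment'
      (fun s hs ↦ (hγd s hs).hasDerivWithinAt) hγ'bound lam
      (right_mem_Icc.2 (by linarith))
    -- `γ(λ) − γ(−λ)` is the second difference
    have hγval : γ lam - γ (-lam) =
        (Φ (z + I * lam) + Φ (conj (z + I * lam))) - (Φ (z - I * lam) + Φ (conj (z - I * lam))) := by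
      have e1 : (z + I * ((-lam : ℝ) : ℂ)) = z - I * lam := by push_cast; ring
      simp only [hγ]
      rw [e1, ← hecp, ← hecm]
      ring
    rw [hγval, show ε * (2 * y) * (lam - -lam) = 4 * lam * y * ε by ring] at hmv
    have hre := (Complex.abs_re_le_norm _).trans hmv
    rw [Complex.sub_re, Complex.add_re, Complex.add_re] at hre
    linarith [(abs_le.1 hre).1]
  -- putting things together: `‖f(z+iλ)‖² ≥ q₀ e^{-4λyε} ‖f(z−iλ)‖² > ‖f(z−iλ)‖²`
  have hexpq : Real.exp (4 * lam * y * ε) < q₀ := hRq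
  have hprodB : 0 ≤ ∏ a ∈ S, (‖z - I * lam - a‖ * ‖z - I * lam - conj a‖) ^ m a :=
    Finset.prod_nonneg fun a _ ↦ by positivity
  have hkey : q₀ * Real.exp (-(4 * lam * y * ε)) * ‖f (z - I * lam)‖ ^ 2 ≤
      ‖f (z + I * lam)‖ ^ 2 := by
    rw [hsqp, hsqm]
    calc q₀ * Real.exp (-(4 * lam * y * ε)) *
          (‖K‖ ^ 2 * (∏ a ∈ S, (‖z - I * lam - a‖ * ‖z - I * lam - conj a‖) ^ m a) *
            Real.exp ((Φ (z - I * lam)).re + (Φ (conj (z - I * lam))).re))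
        = ‖K‖ ^ 2 * (q₀ * ∏ a ∈ S, (‖z - I * lam - a‖ * ‖z - I * lam - conj a‖) ^ m a) *
            Real.exp ((Φ (z - I * lam)).re + (Φ (conj (z - I * lam))).re - 4 * lam * y * ε) := by
          rw [show Real.exp ((Φ (z - I * lam)).re + (Φ (conj (z - I * lam))).re - 4 * lam * y * ε) =
              Real.exp ((Φ (z - I * lam)).re + (Φ (conj (z - I * lam))).re) *
                Real.exp (-(4 * lam * y * ε)) by simp only [← Real.exp_add, sub_eq_add_neg]]
          ring
      _ ≤ ‖K‖ ^ 2 * (∏ a ∈ S, (‖z + I * lam - a‖ * ‖z + I * lam - conj a‖) ^ m a) *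
            Real.exp ((Φ (z + I * lam)).re + (Φ (conj (z + I * lam))).re) := by
          gcongr
  have hposm : 0 < ‖f (z - I * lam)‖ ^ 2 := by positivity
  have hgt : 1 < q₀ * Real.exp (-(4 * lam * y * ε)) := by
    rw [Real.exp_neg, ← div_eq_mul_inv, one_lt_div (Real.exp_pos _)]
    exact hexpq
  have hsqle : ‖f (z + I * lam)‖ ^ 2 ≤ ‖f (z - I * lam)‖ ^ 2 :=
    pow_le_pow_left₀ (norm_nonneg _) hcon 2
  nlinarith

/-! ## de Bruijn's Theorem 8 for strips -/

/-- If `f` (real entire of order `< 2`, zeros in `|Im z| ≤ Δ`) has a zero, then for every real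
`λ` all roots of `f(z + iλ) + f(z − iλ)` lie in `|Im z| ≤ √max(Δ² − λ², 0)`
(de Bruijn 1950, Thm. 8 via Lemma 1; `λ ↦ −λ` and `z ↦ z̄` reduce to `λ > 0`, `Im z > 0`).
[cite: Bruijn1950, Thm. 8] -/
theorem rootsInStrip_shift_of_zero (hf : Differentiable ℂ f) {ρ C : ℝ} (hρ0 : 0 ≤ ρ) (hρ : ρ < 2)
    (hgr : ∀ z, ‖f z‖ ≤ C * Real.exp (‖z‖ ^ ρ)) (hreal : ∀ x : ℝ, (f x).im = 0)
    {Δ : ℝ} (hΔ : 0 ≤ Δ) (hzero : ∀ z, f z = 0 → |z.im| ≤ Δ) {a₀ : ℂ} (ha₀ : f a₀ = 0)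
    (lam : ℝ) :
    RootsInStrip (fun z ↦ f (z + I * lam) + f (z - I * lam))
      (Real.sqrt (max (Δ ^ 2 - lam ^ 2) 0)) := by
  -- reduce to `λ > 0`
  wlog hlam : 0 < lam generalizing lam with H
  · rcases (not_lt.1 hlam).eq_or_lt with h0 | hneg
    · intro z hz
      simp only [h0, ofReal_zero, mul_zero, add_zero, sub_zero] at hz ⊢
      have hfz : f z = 0 := by linear_combination hz / 2
      rw [zero_pow two_ne_zero, sub_zero, max_eq_left (sq_nonneg Δ), Real.sqrt_sq hΔ]
      exact hzero z hfz
    · intro z hz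
      have h := H (-lam) (by linarith) z (by
        simp only [ofReal_neg, mul_neg, sub_neg_eq_add] at hz ⊢
        rwa [add_comm] at hz)
      simpa using h
  intro w hw
  by_contra hcon
  push Not at hcon
  have hsq : Δ ^ 2 < w.im ^ 2 + lam ^ 2 := by
    have h2 : Real.sqrt (max (Δ ^ 2 - lam ^ 2) 0) ^ 2 = max (Δ ^ 2 - lam ^ 2) 0 :=
      Real.sq_sqrt (le_max_right _ _)
    have h3 : Real.sqrt (max (Δ ^ 2 - lam ^ 2) 0) ^ 2 < |w.im| ^ 2 :=
      pow_lt_pow_left₀ hcon (Real.sqrt_nonneg _) two_ne_zero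
    rw [sq_abs, h2] at h3
    have := le_max_left (Δ ^ 2 - lam ^ 2) 0
    linarith
  have hwim : w.im ≠ 0 := fun h ↦ by
    rw [h, abs_zero] at hcon
    exact lt_irrefl _ (hcon.trans_le (Real.sqrt_nonneg _))
  have hnorm : ‖f (w + I * lam)‖ = ‖f (w - I * lam)‖ := by
    rw [show f (w + I * lam) = -f (w - I * lam) by linear_combination hw, norm_neg]
  rcases lt_or_gt_of_ne hwim with hneg | hpos
  · have key := norm_shift_lt_of_strip hf hρ0 hρ hgr hreal hzero ha₀ hlam (z := conj w)
      (by rw [Complex.conj_im]; linarith) (by rwa [Complex.conj_im, neg_sq])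
    rw [show conj w - I * lam = conj (w + I * lam) by apply Complex.ext <;> simp; ring,
      show conj w + I * lam = conj (w - I * lam) by apply Complex.ext <;> simp,
      norm_apply_conj hf hreal, norm_apply_conj hf hreal] at key
    exact absurd hnorm key.ne
  · have key := norm_shift_lt_of_strip hf hρ0 hρ hgr hreal hzero ha₀ hlam hpos hsq
    exact absurd hnorm key.ne'

/-- **de Bruijn 1950, Thm. 8 (`N = 1`) for strips, Hadamard-free.** Let `f` be real entire of
order `< 2` with all zeros in `|Im z| ≤ Δ` (`Δ ≥ 0`), and `λ ∈ ℝ`. Then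
`f(z + iλ) + f(z − iλ)` is either identically zero or has all its roots in the strip
`|Im z| ≤ √max(Δ² − λ², 0)`. (If `f` has a zero: `rootsInStrip_shift_of_zero`; if `f` is
zero-free: `deBruijn_shift_dichotomy`, real roots.) [cite: Bruijn1950, Thm. 8] -/
theorem deBruijn_shift_strip_dichotomy (hf : Differentiable ℂ f) {ρ C : ℝ} (hρ0 : 0 ≤ ρ)
    (hρ : ρ < 2) (hgr : ∀ z, ‖f z‖ ≤ C * Real.exp (‖z‖ ^ ρ)) (hreal : ∀ x : ℝ, (f x).im = 0)
    {Δ : ℝ} (hΔ : 0 ≤ Δ) (hzero : ∀ z, f z = 0 → |z.im| ≤ Δ) (lam : ℝ) :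
    (∀ z, f (z + I * lam) + f (z - I * lam) = 0) ∨
      RootsInStrip (fun z ↦ f (z + I * lam) + f (z - I * lam))
        (Real.sqrt (max (Δ ^ 2 - lam ^ 2) 0)) := by
  by_cases hex : ∃ a, f a = 0
  · obtain ⟨a₀, ha₀⟩ := hex
    exact Or.inr (rootsInStrip_shift_of_zero hf hρ0 hρ hgr hreal hΔ hzero ha₀ lam)
  · push Not at hex
    have hz0 : ∀ z, f z = 0 → z.im = 0 := fun z hz ↦ absurd hz (hex z)
    rcases deBruijn_shift_dichotomy hf hρ0 hρ hgr hreal hz0 lam with h | h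
    · exact Or.inl h
    · exact Or.inr (((rootsInStrip_zero_iff _).2 h).mono (Real.sqrt_nonneg _))

/-- Bookkeeping of the strip widths under iteration:
`√max((√max(Δ² − λ², 0))² − Mλ², 0) = √max(Δ² − (M + 1)λ², 0)`. [folklore] -/
theorem sqrt_max_iterate (Δ lam : ℝ) (M : ℕ) :
    Real.sqrt (max (Real.sqrt (max (Δ ^ 2 - lam ^ 2) 0) ^ 2 - (M : ℝ) * lam ^ 2) 0) =
      Real.sqrt (max (Δ ^ 2 - ((M : ℝ) + 1) * lam ^ 2) 0) := by
  rw [Real.sq_sqrt (le_max_right _ _)]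
  congr 1
  rcases le_or_gt 0 (Δ ^ 2 - lam ^ 2) with h | h
  · rw [max_eq_left h]; ring_nf
  · rw [max_eq_right h.le]
    have hM : (0 : ℝ) ≤ (M : ℝ) * lam ^ 2 := by positivity
    have h1 : Δ ^ 2 - ((M : ℝ) + 1) * lam ^ 2 < 0 := by nlinarith
    rw [max_eq_right h1.le, max_eq_right (by linarith)]

/-- **de Bruijn 1950, Thm. 8 (`φ(u) = (1 + u)^M`) for strips, Hadamard-free.** For `f` real
entire of order `< 2` with all zeros in `|Im z| ≤ Δ` (`Δ ≥ 0`), the `M`-fold iterate of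
`g ↦ g(· + iλ) + g(· − iλ)` applied to `f` is either identically zero or has all its roots in
`|Im z| ≤ √max(Δ² − Mλ², 0)`. [cite: Bruijn1950, Thm. 8] -/
theorem deBruijn_iterate_shift_strip_dichotomy (hf : Differentiable ℂ f) {ρ C : ℝ} (hρ0 : 0 ≤ ρ)
    (hρ : ρ < 2) (hgr : ∀ z, ‖f z‖ ≤ C * Real.exp (‖z‖ ^ ρ)) (hreal : ∀ x : ℝ, (f x).im = 0)
    {Δ : ℝ} (hΔ : 0 ≤ Δ) (hzero : ∀ z, f z = 0 → |z.im| ≤ Δ) (lam : ℝ) (M : ℕ) :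
    (∀ z, ((fun g : ℂ → ℂ ↦ fun z ↦ g (z + I * lam) + g (z - I * lam))^[M] f) z = 0) ∨
      RootsInStrip ((fun g : ℂ → ℂ ↦ fun z ↦ g (z + I * lam) + g (z - I * lam))^[M] f)
        (Real.sqrt (max (Δ ^ 2 - (M : ℝ) * lam ^ 2) 0)) := by
  induction M generalizing f ρ C Δ with
  | zero =>
    refine Or.inr fun z hz ↦ ?_
    rw [Nat.cast_zero, zero_mul, sub_zero, max_eq_left (sq_nonneg Δ), Real.sqrt_sq hΔ]
    exact hzero z hz
  | succ M ih =>
    rw [Function.iterate_succ_apply]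
    rcases deBruijn_shift_strip_dichotomy hf hρ0 hρ hgr hreal hΔ hzero lam with h0 | h1
    · left
      have hF : (fun z ↦ f (z + I * lam) + f (z - I * lam)) = fun _ ↦ 0 := funext h0
      intro z
      rw [hF, iterate_shift_zero]
    · obtain ⟨C', hC'⟩ := norm_shift_le hρ0 hρ hgr lam
      have h := ih (differentiable_shift hf lam) (by positivity) (by linarith) hC'
        (im_shift_ofReal hf hreal lam) (Real.sqrt_nonneg _) h1
      rwa [sqrt_max_iterate, show ((M : ℝ) + 1) = ((M + 1 : ℕ) : ℝ) by push_cast; ring] at h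

end Literature.Analysis.Complex

/-! ## de Bruijn's Theorem 13 for general `Δ` -/

namespace Literature.Analysis.Complex.DeBruijn1950

open MeasureTheory

variable {F : ℝ → ℂ}

/-- **de Bruijn 1950, Thm. 13** (with the target function assumed `≢ 0`; this is the named fact
`DeBruijn1950.thm13` up to that hypothesis, automatic in applications). Let `F` be admissible
(Thm. 10) and suppose the roots of `f(z) = ∫ F(t) e^{izt} dt` lie in the strip `|Im z| ≤ Δ`
(`Δ ≥ 0`). Then the roots of `g(z) = ∫ F(t) e^{λ²t²/2} e^{izt} dt`, if `g ≢ 0`, lie in the strip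
`|Im z| ≤ √max(Δ² − λ², 0)`. Proof (de Bruijn):
`g_N(z) = ∫ F(t) cosh(λt/N)^{N²} e^{izt} dt = 2^{-N²} (T_{λ/N})^{N²} f` is `≡ 0` or has its roots
in `|Im z| ≤ √max(Δ² − N²(λ/N)², 0)` (`Literature.Analysis.Complex.deBruijn_iterate_shift_strip_dichotomy`,
Thm. 8), `g_N → g` locally uniformly (`tendstoLocallyUniformly_trigIntegral`), and Hurwitz's
theorem (`rootsInStrip_of_tendstoLocallyUniformly`, Thm. 7). [cite: Bruijn1950, Thm. 13] -/
theorem rootsInStrip_gaussian (hF : IsAdmissible F) {Δ : ℝ} (hΔ : 0 ≤ Δ) (lam : ℝ)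
    (hroots : RootsInStrip (trigIntegral F) Δ)
    (hne : ∃ z, trigIntegral (fun t ↦ F t * (Real.exp (lam ^ 2 * t ^ 2 / 2) : ℝ)) z ≠ 0) :
    RootsInStrip (trigIntegral fun t ↦ F t * (Real.exp (lam ^ 2 * t ^ 2 / 2) : ℝ))
      (Real.sqrt (max (Δ ^ 2 - lam ^ 2) 0)) := by
  have hFm : AEStronglyMeasurable F := hF.integrable.aestronglyMeasurable
  have hexp := hF.integrable_norm_mul_exp
  -- the kernels
  set k : ℕ → ℝ → ℝ := fun N t ↦ Real.cosh (lam * t / N) ^ (N ^ 2) with hk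
  set K : ℝ → ℝ := fun t ↦ Real.exp (lam ^ 2 * t ^ 2 / 2) with hK
  have hkc : ∀ N, Continuous (k N) := fun N ↦ by simp only [hk]; fun_prop
  have hKc : Continuous K := by simp only [hK]; fun_prop
  have hkK : ∀ N t, |k N t| ≤ K t := fun N t ↦ by
    simp only [hk, hK]
    rw [abs_of_nonneg (pow_nonneg (Real.cosh_pos _).le _)]
    have := cosh_div_pow_sq_le (lam * t) N
    rwa [show (lam * t) ^ 2 / 2 = lam ^ 2 * t ^ 2 / 2 by ring] at this
  have hlim : ∀ t, Tendsto (fun N ↦ k N t) atTop (𝓝 (K t)) := fun t ↦ by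
    simp only [hk, hK]
    have := tendsto_cosh_div_pow_sq (lam * t)
    rwa [show (lam * t) ^ 2 / 2 = lam ^ 2 * t ^ 2 / 2 by ring] at this
  have hmom : ∀ c : ℝ, Integrable fun t ↦ ‖F t‖ * (K t * Real.exp (c * |t|)) := fun c ↦ by
    have e : (fun t ↦ ‖F t‖ * (K t * Real.exp (c * |t|))) =
        fun t ↦ ‖F t‖ * (Real.exp (lam ^ 2 / 2 * t ^ 2) * Real.exp (c * |t|)) := by
      funext t; simp only [hK]; congr 3; ring
    rw [e]
    exact hF.integrable_norm_mul_gaussian (lam ^ 2 / 2) c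
  -- `g_N → g` locally uniformly
  have hconv := tendstoLocallyUniformly_trigIntegral hFm hkc hKc hkK hlim hmom
  -- the function `f` and its properties
  have hfd : Differentiable ℂ (trigIntegral F) := differentiable_trigIntegral hFm hexp
  obtain ⟨ρ, C₀, hρ0, hρ, hgr⟩ := hF.exists_order_bound
  have hreal : ∀ x : ℝ, (trigIntegral F x).im = 0 := isRealOnReal_trigIntegral hF.conj_symm
  -- `g_N = 2^{-N²} T^{N²} f`
  have hgN : ∀ N : ℕ, 0 < N → ∀ z,
      ((fun g : ℂ → ℂ ↦ fun z ↦ g (z + I * (lam / N : ℝ)) + g (z - I * (lam / N : ℝ)))^[N ^ 2]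
        (trigIntegral F)) z = (2 : ℂ) ^ (N ^ 2) * trigIntegral (fun t ↦ F t * (k N t : ℂ)) z := by
    intro N hN z
    rw [iterate_shift_trigIntegral hFm hexp (lam / N) (N ^ 2), trigIntegral_mul_pow_two_cosh]
    congr 3
    funext t
    simp only [hk]
    congr 3
    have hN' : (N : ℝ) ≠ 0 := by exact_mod_cast hN.ne'
    field_simp
  -- eventually `g_N(z₀) ≠ 0`
  obtain ⟨z₀, hz₀⟩ := hne
  have hK' : (fun t ↦ F t * (Real.exp (lam ^ 2 * t ^ 2 / 2) : ℝ)) = fun t ↦ F t * (K t : ℂ) := rfl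
  rw [hK'] at hz₀ ⊢
  have hev0 : ∀ᶠ N : ℕ in atTop, trigIntegral (fun t ↦ F t * (k N t : ℂ)) z₀ ≠ 0 :=
    ((tendstoLocallyUniformlyOn_univ.2 hconv).tendsto_at (mem_univ z₀)).eventually_ne hz₀
  -- eventually `g_N` has its roots in the strip `√max(Δ² − λ², 0)`
  have hevroots : ∀ᶠ N : ℕ in atTop, RootsInStrip (trigIntegral fun t ↦ F t * (k N t : ℂ))
      (Real.sqrt (max (Δ ^ 2 - lam ^ 2) 0)) := by
    filter_upwards [hev0, eventually_gt_atTop 0] with N hN0 hNpos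
    have hdich := Literature.Analysis.Complex.deBruijn_iterate_shift_strip_dichotomy hfd hρ0 hρ hgr hreal hΔ
      hroots (lam / N) (N ^ 2)
    have hN' : (N : ℝ) ≠ 0 := by exact_mod_cast hNpos.ne'
    have hwidth : ((N ^ 2 : ℕ) : ℝ) * (lam / N) ^ 2 = lam ^ 2 := by
      push_cast; field_simp
    rw [hwidth] at hdich
    have h2 : (2 : ℂ) ^ (N ^ 2) ≠ 0 := pow_ne_zero _ two_ne_zero
    rcases hdich with h0 | h1
    · exfalso
      apply hN0
      have := h0 z₀
      rw [hgN N hNpos] at this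
      exact (mul_eq_zero.1 this).resolve_left h2
    · intro z hz
      apply h1 z
      rw [hgN N hNpos, hz, mul_zero]
  have hevdiff : ∀ᶠ N : ℕ in atTop, Differentiable ℂ (trigIntegral fun t ↦ F t * (k N t : ℂ)) :=
    Eventually.of_forall fun N ↦ differentiable_trigIntegral_mul hFm (hkc N) (hkK N) hmom
  exact rootsInStrip_of_tendstoLocallyUniformly hevdiff hconv hevroots ⟨z₀, hz₀⟩

end Literature.Analysis.Complex.DeBruijn1950
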